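import Summits.BirchSwinnertonDyer.Rank1Residual.X12.InertCoreUpperHalf
import Summits.BirchSwinnertonDyer.Rank1Residual.X2.TwistTamagawa
import Literature.NumberTheory.EllipticCurves.HeegnerHypothesisKroneckerProofs
import HarnessLib

/-!
# X12 at EVERY ODD bad prime unramified in the CM field — the `p = 3` inert-bad sub-family joins
# the core: the UPPER HALF of `BSD(E,p)` from PUBLISHED theorems (cell `b2b-bsdres`, unit
# `b2b-bsdres-x1b`, gen 12)

HONEST FRAMING (cell `b2b-bsdres`, run/shared/lean/b2b/bsd-rank1-residual/, verbatim in every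
file): the goal of the cell is to DELETE the COMBINATION-SHAPED residual classes of the
Birch–Swinnerton-Dyer formula for ALL analytic-rank `≤ 1` elliptic curves over `ℚ` — "full BSD
formula for every rank `≤ 1` curve in class `C`" assembled STRICTLY from published theorems — so
that the rank-`≤ 1` remainder becomes exactly the CONSTRUCTION-SHAPED classes, which are TYPED
(missing-input `Prop`s), NOT attempted. This is not "finishing BSD". Unit `b2b-bsdres-x1b`
(CLASS-OWNERS row "X12 inert-bad core", prover owner), generation 12; research route, no claim
beyond the stated class; X12 REMAINS CONSTRUCTION-SHAPED; nothing is booked.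
Theorems only; no definition, no new named fact.

## What is new: `p = 3`

Gen 9 (`X12/InertCoreUpperHalf.lean`) proved the Euler-system (upper) half of `BSD(E,p)` on the
X12 inert-bad core for `p ≥ 5` (CM, `ord_{s=1} L(E,s) = 1`, `p ∣ N`, `p ∤ d_K`; modulo the Manin
datum `p ∤ c(D)` and `p ∤ ∏ c_ℓ`). The bound `p ≥ 5` entered at ONE place: the transport
`ord_p ∏_ℓ c_ℓ(E^{(d_{K'})}) = ord_p ∏_ℓ c_ℓ(E)` to the Heegner twist, by Kodaira–Néron
`c_ℓ ≤ 4 < p` at the primes `ℓ ∣ d_{K'}` (multr1-p2). At `p = 3`, `c ≤ 4` does not exclude `c = 3`;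
the Kodaira TYPE does: taking the Friedberg–Hoffstein field `K'` with `2` split as well (the tree's
fact carries a free prescribed-split prime; we spend it on `2`), `d_{K'}` is odd, `3 ∣ N` splits in
`K'` so `3 ∤ d_{K'}`, hence every `ℓ ∣ d_{K'}` is `≥ 5` with `ℓ ∥ d_{K'}` and `E` good at `ℓ`, and
`E^{(d_{K'})}` has type `I₀*` at `ℓ`, `c_ℓ ∈ {1, 2, 4}` — eisenstein-p2's
`X2.padicValNat_tamagawaProduct_twist_of_heegner_of_odd` (`X2/TwistKodaira.lean`: Tate's algorithm
Step 6 in the tree). Everything else in gen 9's argument is stated for `p ≠ 2` (Matar–Nekovář's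
irreducible form of Kolyvagin: `p ≠ 2`, `d_{K'} ≠ −3, −4`; `E[p]` irreducible for CM at every odd
`p ∤ d_K`, harvest-1; the descent `X11b.padicValNat_shaOrder_le_add_of_shaIndexBound`: `p ≠ 2`).

So the X12 pairs `(E, 3)` with `3 ∣ N` and `K ≠ ℚ(√−3)` — the CM curves with `j ≠ 0` ADDITIVE at
`3` (`3` inert in `K = ℚ(i), ℚ(√−7), …`): 21 rank-one class-pairs with `N < 2·10⁴` (`288a1, 441d1,
576h1, 2304a1/b1/p1, 7200a1/bd1/be1/bg1/q1, 11025y1, 14112bj1/bk1/bn1/x1, 14400db1/dc1/dd1/de1/dn1`),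
154 with `N < 5·10⁵` (x1b gen 11 scan of the Kurihara lane's files) — get the SAME class-level
statement as the `p ≥ 5` core: the UPPER half of `BSD(E,3)` from published facts, modulo the Manin
datum and the Tamagawa datum `3 ∤ ∏ c_ℓ(E)` (genuine at `p = 3`: `c_ℓ = 3` occurs for types
`IV`/`IV*`), and `BSD(E,3)` from the pair's OWN lower half alone; per pair, route T-KR.
Statements: `padicValNat_shaOrder_le_of_hasCM_rankOne_of_bad_odd` (data → class, any odd `p`; the
`p ≥ 5` case recovers gen 9), `missingUpperBoundAt_of_hasCM_rankOne_of_bad_odd`,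
`bsdp_of_hasCM_rankOne_of_bad_odd_of_lower`; class-keyed (`ClassX12 W p`, `¬ Good W p` — at `p = 3`
the class also holds Kobayashi's GOOD inert pairs —, `¬ CMRamified W p`, `p ≠ 2`):
`missingUpperBoundAt_of_classX12_of_bad_odd`, `missingInputAt_of_classX12_of_bad_odd_of_lower`,
`bsdp_of_classX12_of_bad_odd_of_lower`, `bsdp_of_classX12_of_bad_odd_of_shaAn_unit` (T-KR); at
`p = 3`: `missingUpperBoundAt_three_of_classX12_of_bad`, `bsdp_three_of_classX12_of_bad_of_lower`,
`bsdp_three_of_classX12_of_bad_of_shaAn_unit`. Binders: the PUBLISHED named facts of gen 9 (`hGZ`,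
`hKo`, `hMN`, `hGZK`, `hmod`, `hnf`, `hFH`, `hCM8`).

READING for the cell (no label change; nothing booked; X12 CONSTRUCTION-SHAPED): the `p = 3`
inert-bad sub-family of X12 has the same typed residue as the `p ≥ 5` core — the pair's own LOWER
half `MissingLowerBoundAt W 3` (no print); per pair it is T-KR-shaped (published facts + Manin
datum + `3 ∤ ∏c_ℓ` + certified `ord_3 #Ш_an = 0`).

References: [MatarNekovar2019] Thm. 0.3, §0.4, §0.11; [JetchevSkinnerWan2017] §7.4;
[SilvermanATAEC1994] IV.9.4 Step 6 / Table 4.1; [BurungaleFlach2024] Thm. 1.1 / Cor. 2;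
[Rubin1991MainConj] Thm. 11.1; [Miller2011LMS] Def. 1.1; [FriedbergHoffstein1995] main theorem.
-/

noncomputable section

open scoped Classical NumberField

open WeierstrassCurve NumberField Literature.NumberTheory.EllipticCurves
  Literature.NumberTheory.EllipticCurves.ModularForms
  Literature.NumberTheory.EllipticCurves.Rank1Residual
  Literature.NumberTheory.EllipticCurves.Rank1Residual.Typed
  Literature.NumberTheory.Automorphic
  IsDedekindDomain

namespace Summit.BirchSwinnertonDyer.Rank1Residual.X12

/-! The PUBLISHED named facts of the tree used throughout (binders of every theorem below, exactly
as in gen 9's `X12/InertCoreUpperHalf.lean`): Gross–Zagier, Kolyvagin's finiteness, Kolyvagin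
Cor. 13 in Matar–Nekovář's irreducible form, GZK, modularity (two spellings), Friedberg–Hoffstein,
and the rank-zero CM formula (Rubin 1991 + Burungale–Flach 2024 = covered row C8). -/
variable
  (hGZ : ∀ (N : ℕ) [NeZero N] (W : WeierstrassCurve ℚ) (K : Type) [Field K] [NumberField K],
    gross_zagier N W K)
  (hKo : ∀ (N : ℕ) [NeZero N] (W : WeierstrassCurve ℚ) (K : Type) [Field K] [NumberField K],
    kolyvagin N W K)
  (hMN : ∀ (N : ℕ) [NeZero N] (W : WeierstrassCurve ℚ) (K : Type) [Field K] [NumberField K],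
    MatarNekovar2019.thm03_padicValNat_card_sha_le_of_irreducible N W K)
  (hGZK : rank_eq_analyticRank_of_analyticRank_le_one) (hmod : hasEntireLFunction_rat)
  (hnf : exists_isNewformOf) (hFH : friedbergHoffstein_exists_heegnerField_split_twist_ne_zero)
  (hCM8 : bsdTriple_of_hasCM_of_L_one_ne_zero)

include hGZ hKo hMN hGZK hmod hnf hFH hCM8

/-! ### §1 Data → class: Kolyvagin's Tamagawa defect at any ODD bad prime unramified in the CM field -/

/-- **Kolyvagin's Tamagawa defect on X12 at every ODD bad prime unramified in the CM field — from
PUBLISHED facts only.** Let `W/ℚ` be a globally minimal CM curve (`hCM`) with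
`ord_{s=1} L(E,s) = 1`, `p ≠ 2` a prime of BAD reduction (`p ∣ N`, additive) UNRAMIFIED in the CM
field (`¬ CMRamified W p`), and `D` a modular parametrisation datum of level `N_E` with `p ∤ c(D)`
(Manin datum). Then `#Ш(E)_an = q ∈ ℚ` with `ord_p #Ш(E) ≤ ord_p q + 2·ord_p ∏_ℓ c_ℓ(E)`.
The `p ≥ 5` case is gen 9's `padicValNat_shaOrder_le_of_hasCM_rankOne_of_bad`; NEW is `p = 3`
(`K ≠ ℚ(√−3)`). Proof: `E[p]` irreducible (`irr_of_not_cmRamified`); Friedberg–Hoffstein field `K'`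
with every `ℓ ∣ N` AND `2` split, `|d_{K'}| > 4`, `L(E^{(d_{K'})},1) ≠ 0` — so `d_{K'}` is odd
(`SatisfiesHeegnerHypothesis.not_dvd_discr` at `2`) and `p ∤ d_{K'}` (same at `p ∣ N`); Heegner
datum and `K'`-point of `D` (Gross 1984 / Darmon Thm. 3.6); the twist `E^{(d)}` is CM of analytic
rank `0`, so its LOWER half is a theorem (`missingLowerBoundAt_twist_of_hasCM`: Rubin / Burungale–
Flach); transports to the minimal twist model: irreducibility (x11b), the unit
(`AdditivePotMult.padicValRat_u_eq_zero_of_twist_minimal_of_dvd`), and the Tamagawa `p`-valuation at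
every ODD `p ∤ d_{K'}` (eisenstein-p2's `X2.padicValNat_tamagawaProduct_twist_of_heegner_of_odd`:
type `I₀*` at `ℓ ∣ d_{K'}`, `ℓ ≥ 5`); then multr1-p2's class-agnostic descent
`X11b.padicValNat_shaOrder_le_add_of_shaIndexBound` with Kolyvagin's bound in Matar–Nekovář's
irreducible form (`hMN`). [cite: MatarNekovar2019, Thm. 0.3, §0.4, §0.11, Cor. 5.21, Prop. 5.26 (2)]
[cite: JetchevSkinnerWan2017, §7.4.2 (p. 31)] [cite: SilvermanATAEC1994, IV.9.4 Step 6 and Table 4.1]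
[cite: BurungaleFlach2024, Thm. 1.1 and Cor. 2] [cite: Darmon2004, Thm. 3.6 and §3.7]
[cite: Miller2011LMS, Def. 1.1] -/
theorem padicValNat_shaOrder_le_of_hasCM_rankOne_of_bad_odd
    (W : WeierstrassCurve ℚ) [W.IsElliptic] [W.IsGloballyMinimal] (p : ℕ) [Fact p.Prime]
    [NeZero (W.conductorNorm ℤ)]
    (hCM : W.HasCM) (hr : W.analyticRank = 1) (hp2 : p ≠ 2) (hbad : ¬ Good W p)
    (hnr : ¬ CMRamified W p)
    (D : ModularParametrizationData W (W.conductorNorm ℤ)) (hc : ¬ (p : ℤ) ∣ D.c) :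
    ∃ q : ℚ, shaAn W = (q : ℂ) ∧
      (padicValNat p W.shaOrder : ℤ) ≤ padicValRat p q + 2 * padicValNat p W.tamagawaProduct := by
  have hp : p.Prime := Fact.out
  have hpN : p ∣ W.conductorNorm ℤ := (W.dvd_conductorNorm_iff_not_hasGoodReductionAtPrime p).mpr hbad
  -- `E[p]` is irreducible: CM, `p` odd and unramified in the CM field
  have hirr : Irr W p := irr_of_not_cmRamified W p hp2 hnr
  -- the sign of the functional equation is `−1` (modularity, `r_an = 1`)
  have hw : W.rootNumber = -1 := by
    rw [WeierstrassCurve.rootNumber_eq_neg_one_pow_analyticRank_of_exists_isNewformOf hnf W, hr]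
    norm_num
  -- the auxiliary field (Friedberg–Hoffstein): every `ℓ ∣ N` split, `2` split, `|d_K'| > 4`,
  -- `L(E^{d_K'},1) ≠ 0`
  obtain ⟨K, _, _, hK, hdisc, hHN, hH2, hLt⟩ := hFH W hw 2 Nat.prime_two 4
  -- `d_K'` is odd (`2` splits) and prime to `p` (`p ∣ N` splits)
  have hodd : Odd (NumberField.discr K) := by
    have h2 : ¬ (2 : ℤ) ∣ NumberField.discr K := by
      simpa using Literature.SatisfiesHeegnerHypothesis.not_dvd_discr hK.1 hH2 Nat.prime_two
        (dvd_refl 2)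
    exact Int.not_even_iff_odd.mp fun he ↦ h2 (even_iff_two_dvd.mp he)
  have hpd : ¬ (p : ℤ) ∣ NumberField.discr K :=
    Literature.SatisfiesHeegnerHypothesis.not_dvd_discr hK.1 hHN hp hpN
  -- `w_K' = 2`, prime to `p` odd; `d_K' ≠ −3, −4`
  have hneg : NumberField.discr K < 0 := by
    haveI : IsTotallyComplex K := hK.2
    exact discr_neg_of_finrank_eq_two K hK.1
  have h4 : NumberField.discr K < -4 := by
    have habs : ((NumberField.discr K).natAbs : ℤ) = -NumberField.discr K :=
      Int.ofNat_natAbs_of_nonpos hneg.le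
    have : (4 : ℤ) < ((NumberField.discr K).natAbs : ℤ) := by exact_mod_cast hdisc
    omega
  have hμ : ¬ p ∣ Units.torsionOrder K := by
    rw [Literature.NumberTheory.DiophantineGeometry.torsionOrder_eq_two_of_discr_lt hK.1 h4]
    intro h2
    have := Nat.le_of_dvd two_pos h2
    interval_cases p <;> simp_all
  have hD3 : NumberField.discr K ≠ -3 := by omega
  have hD4 : NumberField.discr K ≠ -4 := by omega
  -- the Heegner datum and the `K'`-rational Heegner point of the given parametrisation datum `D`
  obtain ⟨β, hβ⟩ := exists_dvd_sq_sub_discr_holds (W.conductorNorm ℤ) K hK hHN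
  obtain ⟨H, -⟩ := nonempty_heegnerDatum_holds (W.conductorNorm ℤ) K hK hβ
  obtain ⟨ι⟩ : Nonempty (K →+* ℂ) := inferInstance
  obtain ⟨P, hP⟩ := heegnerPointComplex_mem_range_map_holds (W.conductorNorm ℤ) W K hK hHN D H ι
  -- a globally minimal model of the twist
  have hD0 : (NumberField.discr K : ℚ) ≠ 0 := by exact_mod_cast NumberField.discr_ne_zero K
  haveI hEt : (W.quadraticTwist (NumberField.discr K : ℚ)).IsElliptic :=
    W.isElliptic_quadraticTwist hD0
  obtain ⟨Cd, hCd⟩ := hasGlobalMinimalModel_rat_holds (W.quadraticTwist (NumberField.discr K : ℚ))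
  haveI : (Cd • W.quadraticTwist (NumberField.discr K : ℚ)).IsGloballyMinimal := hCd
  have hWd : Cd • W.quadraticTwist (NumberField.discr K : ℚ) =
      Cd • W.quadraticTwist (NumberField.discr K : ℚ) := rfl
  -- the twist has analytic rank `0`, and — being CM of rank zero — its LOWER half is a theorem
  have hrd : (Cd • W.quadraticTwist (NumberField.discr K : ℚ)).analyticRank = 0 := by
    rw [analyticRank_smul]
    exact analyticRank_eq_zero_of_entireLFunction_one_ne_zero _ hLt
  have hlowd : MissingLowerBoundAt (Cd • W.quadraticTwist (NumberField.discr K : ℚ)) p :=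
    missingLowerBoundAt_twist_of_hasCM hCM8 hmod hGZK W hCM p hD0
      (Cd • W.quadraticTwist (NumberField.discr K : ℚ)) ⟨Cd, rfl⟩ hrd
  -- transports to the minimal twist model: irreducibility, Tamagawa `p`-valuation (odd `p ∤ d_K'`:
  -- type `I₀*` at the primes `ℓ ∣ d_K'`, all `≥ 5`), the unit
  have hirrd : (Cd • W.quadraticTwist (NumberField.discr K : ℚ)).HasIrreducibleModPGaloisRep p :=
    X11b.hasIrreducibleModPGaloisRep_twist_model W p K hK.1 hirr Cd hWd
  have htam : padicValNat p (Cd • W.quadraticTwist (NumberField.discr K : ℚ)).tamagawaProduct =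
      padicValNat p W.tamagawaProduct :=
    X2.padicValNat_tamagawaProduct_twist_of_heegner_of_odd W p hp2 K hK hodd hpd hHN Cd hWd
  have hu : padicValRat p (Cd.u : ℚ) = 0 :=
    AdditivePotMult.padicValRat_u_eq_zero_of_twist_minimal_of_dvd W p K hK hHN hpN Cd hWd
  -- the twist's lower half in print shape
  obtain ⟨qd, hqd, hvqd⟩ :=
    AdditivePotMult.exists_printShape_lower_of_missingLowerBoundAt_rankZero (p := p)
      (Cd • W.quadraticTwist (NumberField.discr K : ℚ)) hGZK hrd hirrd hlowd
  -- multr1-p2's class-agnostic descent, the Kolyvagin-shape bound supplied by Matar–Nekovář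
  exact X11b.padicValNat_shaOrder_le_add_of_shaIndexBound W p (W.conductorNorm ℤ) K D H ι P
    (hGZ _ W K) (hKo _ W K) hGZK hmod hK hHN hP hp2 hc hμ hr hLt
    (Cd • W.quadraticTwist (NumberField.discr K : ℚ)) Cd hWd hu htam ⟨qd, hqd, hvqd⟩
    (fun _ hnt ↦ hMN _ W K hK hHN hD3 hD4 ⟨D, H, ι, hP⟩ hnt hp hp2 hirr)

/-- **The UPPER half on X12 at every odd bad prime unramified in the CM field** (same hypotheses,
plus `p ∤ ∏_ℓ c_ℓ(E)` — automatic for `p ≥ 5`, `not_dvd_tamagawaProduct_of_hasCM`; a per-pair DATUM at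
`p = 3`): `Typed.MissingUpperBoundAt W p`, i.e. `ord_p #Ш(E) ≤ ord_p #Ш(E)_an`.
[cite: MatarNekovar2019, Thm. 0.3 and §0.11] [cite: BurungaleFlach2024, Thm. 1.1 and Cor. 2]
[cite: Miller2011LMS, Def. 1.1] -/
theorem missingUpperBoundAt_of_hasCM_rankOne_of_bad_odd
    (W : WeierstrassCurve ℚ) [W.IsElliptic] [W.IsGloballyMinimal] (p : ℕ) [Fact p.Prime]
    [NeZero (W.conductorNorm ℤ)]
    (hCM : W.HasCM) (hr : W.analyticRank = 1) (hp2 : p ≠ 2) (hbad : ¬ Good W p)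
    (hnr : ¬ CMRamified W p)
    (D : ModularParametrizationData W (W.conductorNorm ℤ)) (hc : ¬ (p : ℤ) ∣ D.c)
    (htam : ¬ p ∣ W.tamagawaProduct) :
    MissingUpperBoundAt W p := by
  obtain ⟨q, hq, hle⟩ := padicValNat_shaOrder_le_of_hasCM_rankOne_of_bad_odd hGZ hKo hMN hGZK hmod
    hnf hFH hCM8 W p hCM hr hp2 hbad hnr D hc
  refine ⟨q, hq, ?_⟩
  rw [padicValNat.eq_zero_of_not_dvd htam, Nat.cast_zero, mul_zero, add_zero] at hle
  exact hle

/-- **`BSD(E,p)` on X12 at every odd bad prime unramified in the CM field, from the pair's OWN LOWER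
half alone** (same hypotheses, plus `MissingLowerBoundAt W p` for `E` itself).
[cite: MatarNekovar2019, Thm. 0.3 and §0.11] [cite: Miller2011LMS, §1 and Def. 1.1] -/
theorem bsdp_of_hasCM_rankOne_of_bad_odd_of_lower
    (W : WeierstrassCurve ℚ) [W.IsElliptic] [W.IsGloballyMinimal] (p : ℕ) [Fact p.Prime]
    [NeZero (W.conductorNorm ℤ)]
    (hCM : W.HasCM) (hr : W.analyticRank = 1) (hp2 : p ≠ 2) (hbad : ¬ Good W p)
    (hnr : ¬ CMRamified W p)
    (D : ModularParametrizationData W (W.conductorNorm ℤ)) (hc : ¬ (p : ℤ) ∣ D.c)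
    (htam : ¬ p ∣ W.tamagawaProduct) (hlowW : MissingLowerBoundAt W p) :
    BSDp W p :=
  bsdp_of_missingPPartAt W p hGZK (by rw [hr])
    (missingPPartAt_of_lower_of_upper W p hlowW
      (missingUpperBoundAt_of_hasCM_rankOne_of_bad_odd hGZ hKo hMN hGZK hmod hnf hFH hCM8 W p hCM hr
        hp2 hbad hnr D hc htam))

/-! ### §2 In the cell's class vocabulary (`ClassX12`, `X12.MissingInputAt`), any odd bad `p` -/

/-- **X12 ∧ `p ≠ 2` ∧ `p ∣ N` ∧ `p ∤ d_K` (the `p ≥ 5` inert-bad core, its `p = 3` sub-family, and the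
Li–Liu–Tian split-bad corner): the UPPER half of `BSD(E,p)` from published facts**, modulo the Manin
datum `p ∤ c(D)` and `p ∤ ∏c_ℓ`. (At `p = 3` the class `ClassX12 W 3` also contains the GOOD inert
pairs — Kobayashi's corner — whence the explicit hypothesis `¬ Good W p`.)
[cite: MatarNekovar2019, Thm. 0.3 and §0.11] [cite: BurungaleFlach2024, Thm. 1.1 and Cor. 2]
[cite: Miller2011LMS, Def. 1.1] -/
theorem missingUpperBoundAt_of_classX12_of_bad_odd
    (W : WeierstrassCurve ℚ) [W.IsElliptic] [W.IsGloballyMinimal] (p : ℕ) [Fact p.Prime]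
    [NeZero (W.conductorNorm ℤ)]
    (hX : ClassX12 W p) (hp2 : p ≠ 2) (hbad : ¬ Good W p) (hnr : ¬ CMRamified W p)
    (D : ModularParametrizationData W (W.conductorNorm ℤ)) (hc : ¬ (p : ℤ) ∣ D.c)
    (htam : ¬ p ∣ W.tamagawaProduct) :
    MissingUpperBoundAt W p :=
  missingUpperBoundAt_of_hasCM_rankOne_of_bad_odd hGZ hKo hMN hGZK hmod hnf hFH hCM8 W p hX.1 hX.2.1
    hp2 hbad hnr D hc htam

/-- **The typed residue of X12 shrinks to the LOWER half at every odd bad `p ∤ d_K`, `p = 3`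
included**: given the pair's own `MissingLowerBoundAt W p`, the cell's typed input
`X12.MissingInputAt W p` HOLDS (modulo Manin datum and `p ∤ ∏c_ℓ`). X12 stays CONSTRUCTION-SHAPED;
nothing booked. [cite: MatarNekovar2019, Thm. 0.3 and §0.11] [cite: Miller2011LMS, §1 and Def. 1.1] -/
theorem missingInputAt_of_classX12_of_bad_odd_of_lower
    (W : WeierstrassCurve ℚ) [W.IsElliptic] [W.IsGloballyMinimal] (p : ℕ) [Fact p.Prime]
    [NeZero (W.conductorNorm ℤ)]
    (hX : ClassX12 W p) (hp2 : p ≠ 2) (hbad : ¬ Good W p) (hnr : ¬ CMRamified W p)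
    (D : ModularParametrizationData W (W.conductorNorm ℤ)) (hc : ¬ (p : ℤ) ∣ D.c)
    (htam : ¬ p ∣ W.tamagawaProduct) (hlowW : MissingLowerBoundAt W p) :
    X12.MissingInputAt W p := fun _ ↦
  missingPPartAt_of_lower_of_upper W p hlowW
    (missingUpperBoundAt_of_classX12_of_bad_odd hGZ hKo hMN hGZK hmod hnf hFH hCM8 W p hX hp2 hbad
      hnr D hc htam)

/-- **… and `BSD(E,p)` there from the pair's own lower half** (class-keyed form of
`bsdp_of_hasCM_rankOne_of_bad_odd_of_lower`). [cite: MatarNekovar2019, Thm. 0.3 and §0.11]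
[cite: Miller2011LMS, §1 and Def. 1.1] -/
theorem bsdp_of_classX12_of_bad_odd_of_lower
    (W : WeierstrassCurve ℚ) [W.IsElliptic] [W.IsGloballyMinimal] (p : ℕ) [Fact p.Prime]
    [NeZero (W.conductorNorm ℤ)]
    (hX : ClassX12 W p) (hp2 : p ≠ 2) (hbad : ¬ Good W p) (hnr : ¬ CMRamified W p)
    (D : ModularParametrizationData W (W.conductorNorm ℤ)) (hc : ¬ (p : ℤ) ∣ D.c)
    (htam : ¬ p ∣ W.tamagawaProduct) (hlowW : MissingLowerBoundAt W p) :
    BSDp W p :=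
  bsdp_of_hasCM_rankOne_of_bad_odd_of_lower hGZ hKo hMN hGZK hmod hnf hFH hCM8 W p hX.1 hX.2.1 hp2
    hbad hnr D hc htam hlowW

/-- **Route T-KR at every odd bad `p ∤ d_K`, `p = 3` included** (Kolyvagin bound ∘ Rubin
cancellation; x1b gen 9 for `p ≥ 5`): the class-level UPPER half plus a CERTIFIED
`ord_p #Ш(E)_an = 0` give `BSD(E,p)` — with `ord_p q = 0` the upper half reads `Ш(E)[p] = 0`, which
is the exact `p`-part. NO Heegner index, NO descent; inputs beyond the published facts: the Manin
datum `p ∤ c(D)`, `p ∤ ∏c_ℓ`, `r_an = 1` (in `ClassX12`), and the exact `#Ш_an`.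
[cite: MatarNekovar2019, Thm. 0.3 and §0.11] [cite: Miller2011LMS, §1 and Def. 1.1] -/
theorem bsdp_of_classX12_of_bad_odd_of_shaAn_unit
    (W : WeierstrassCurve ℚ) [W.IsElliptic] [W.IsGloballyMinimal] (p : ℕ) [Fact p.Prime]
    [NeZero (W.conductorNorm ℤ)]
    (hX : ClassX12 W p) (hp2 : p ≠ 2) (hbad : ¬ Good W p) (hnr : ¬ CMRamified W p)
    (D : ModularParametrizationData W (W.conductorNorm ℤ)) (hc : ¬ (p : ℤ) ∣ D.c)
    (htam : ¬ p ∣ W.tamagawaProduct)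
    {q : ℚ} (hq : shaAn W = (q : ℂ)) (hv : padicValRat p q = 0) : BSDp W p := by
  obtain ⟨q', hq', hle⟩ := missingUpperBoundAt_of_classX12_of_bad_odd hGZ hKo hMN hGZK hmod hnf hFH
    hCM8 W p hX hp2 hbad hnr D hc htam
  have hqq : q' = q := by exact_mod_cast hq'.symm.trans hq
  subst hqq
  rw [hv] at hle
  have h0 : padicValNat p W.shaOrder = 0 := by exact_mod_cast le_antisymm hle (by positivity)
  exact bsdp_of_missingPPartAt W p hGZK (by rw [hX.2.1]) ⟨q', hq', by rw [hv, h0, Nat.cast_zero]⟩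

/-! ### §3 The `p = 3` corner spelled out (CM by `K ≠ ℚ(√−3)`, `3 ∣ N`) -/

section Three

/-- **X12 at `p = 3`, `3 ∣ N`, `K ≠ ℚ(√−3)`: the UPPER half of `BSD(E,3)` from published facts**,
modulo the Manin datum `3 ∤ c(D)` and the Tamagawa datum `3 ∤ ∏c_ℓ(E)`. These are the CM curves
with `j ≠ 0` additive at `3` (`3` inert in `K = ℚ(i), ℚ(√−7), ℚ(√−19), …`, or split in
`ℚ(√−2), ℚ(√−11)`): 21 rank-one class-pairs with `N < 2·10⁴`, 154 with `N < 5·10⁵` at `3` inert.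
[cite: MatarNekovar2019, Thm. 0.3 and §0.11] [cite: SilvermanATAEC1994, IV.9.4 Step 6 and Table 4.1]
[cite: Miller2011LMS, Def. 1.1] -/
theorem missingUpperBoundAt_three_of_classX12_of_bad
    (W : WeierstrassCurve ℚ) [W.IsElliptic] [W.IsGloballyMinimal] [NeZero (W.conductorNorm ℤ)]
    (hX : ClassX12 W 3) (hbad : ¬ Good W 3) (hnr : ¬ CMRamified W 3)
    (D : ModularParametrizationData W (W.conductorNorm ℤ)) (hc : ¬ (3 : ℤ) ∣ D.c)
    (htam : ¬ 3 ∣ W.tamagawaProduct) :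
    MissingUpperBoundAt W 3 :=
  missingUpperBoundAt_of_classX12_of_bad_odd hGZ hKo hMN hGZK hmod hnf hFH hCM8 W 3 hX (by decide)
    hbad hnr D (by exact_mod_cast hc) htam

/-- **X12 at `p = 3`, `3 ∣ N`, `K ≠ ℚ(√−3)`: `BSD(E,3)` from the pair's OWN lower half**
`MissingLowerBoundAt W 3` (modulo Manin datum and `3 ∤ ∏c_ℓ`) — the `p = 3` inert-bad sub-family has
the same typed residue as the `p ≥ 5` core. [cite: MatarNekovar2019, Thm. 0.3 and §0.11]
[cite: Miller2011LMS, §1 and Def. 1.1] -/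
theorem bsdp_three_of_classX12_of_bad_of_lower
    (W : WeierstrassCurve ℚ) [W.IsElliptic] [W.IsGloballyMinimal] [NeZero (W.conductorNorm ℤ)]
    (hX : ClassX12 W 3) (hbad : ¬ Good W 3) (hnr : ¬ CMRamified W 3)
    (D : ModularParametrizationData W (W.conductorNorm ℤ)) (hc : ¬ (3 : ℤ) ∣ D.c)
    (htam : ¬ 3 ∣ W.tamagawaProduct) (hlowW : MissingLowerBoundAt W 3) :
    BSDp W 3 :=
  bsdp_of_classX12_of_bad_odd_of_lower hGZ hKo hMN hGZK hmod hnf hFH hCM8 W 3 hX (by decide) hbad hnr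
    D (by exact_mod_cast hc) htam hlowW

/-- **Route T-KR at `p = 3` on X12** (`3 ∣ N`, `K ≠ ℚ(√−3)`): published facts + Manin datum +
`3 ∤ ∏c_ℓ` + a CERTIFIED `ord_3 #Ш(E)_an = 0` ⟹ `BSD(E,3)`. Offered to the Kurihara lane as the
index-free per-pair lever for the 21 window / 154 census CM-inert additive `p = 3` cells (all with
`ord_3 #Ш_an = 0` on the lane's files). [cite: MatarNekovar2019, Thm. 0.3 and §0.11]
[cite: Miller2011LMS, §1 and Def. 1.1] -/
theorem bsdp_three_of_classX12_of_bad_of_shaAn_unit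
    (W : WeierstrassCurve ℚ) [W.IsElliptic] [W.IsGloballyMinimal] [NeZero (W.conductorNorm ℤ)]
    (hX : ClassX12 W 3) (hbad : ¬ Good W 3) (hnr : ¬ CMRamified W 3)
    (D : ModularParametrizationData W (W.conductorNorm ℤ)) (hc : ¬ (3 : ℤ) ∣ D.c)
    (htam : ¬ 3 ∣ W.tamagawaProduct)
    {q : ℚ} (hq : shaAn W = (q : ℂ)) (hv : padicValRat 3 q = 0) : BSDp W 3 :=
  bsdp_of_classX12_of_bad_odd_of_shaAn_unit hGZ hKo hMN hGZK hmod hnf hFH hCM8 W 3 hX (by decide)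
    hbad hnr D (by exact_mod_cast hc) htam hq hv

end Three

/-! ### §4 (appended, gen 12) The class sentence: `BSD(E,p) ⟺` the pair's own LOWER half -/

/-- **On X12 ∧ `p ≠ 2` ∧ `p ∣ N` ∧ `p ∤ d_K` (the `p ≥ 5` core AND its `p = 3` sub-family), modulo
the Manin datum `p ∤ c(D)` and `p ∤ ∏c_ℓ(E)`: `BSD(E,p) ⟺ MissingLowerBoundAt W p`.** "⇐" is the
upper half from published facts (`bsdp_of_classX12_of_bad_odd_of_lower`); "⇒" is bookkeeping (`Ш`
finite by GZK in analytic rank one). The odd-prime form of gen 9's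
`bsdp_iff_missingLowerBoundAt_of_classX12_of_not_cmRamified` (`X12/InertCoreRecords.lean`, `p ≥ 5`):
the typed residue of the whole odd inert-bad part of X12 is the pair's own lower half. Nothing
booked; X12 stays CONSTRUCTION-SHAPED. [cite: MatarNekovar2019, Thm. 0.3 and §0.11]
[cite: Miller2011LMS, §1 and Def. 1.1] -/
theorem bsdp_iff_missingLowerBoundAt_of_classX12_of_bad_odd
    (W : WeierstrassCurve ℚ) [W.IsElliptic] [W.IsGloballyMinimal] (p : ℕ) [Fact p.Prime]
    [NeZero (W.conductorNorm ℤ)]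
    (hX : ClassX12 W p) (hp2 : p ≠ 2) (hbad : ¬ Good W p) (hnr : ¬ CMRamified W p)
    (D : ModularParametrizationData W (W.conductorNorm ℤ)) (hc : ¬ (p : ℤ) ∣ D.c)
    (htam : ¬ p ∣ W.tamagawaProduct) :
    BSDp W p ↔ MissingLowerBoundAt W p := by
  refine ⟨fun hb ↦ ?_, fun hlow ↦ ?_⟩
  · haveI : Finite W.sha := (hGZK W (by rw [hX.2.1])).2
    exact (lower_and_upper_of_missingPPartAt W p (missingPPartAt_of_bsdp W p hb)).1
  · exact bsdp_of_classX12_of_bad_odd_of_lower hGZ hKo hMN hGZK hmod hnf hFH hCM8 W p hX hp2 hbad hnr D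
      hc htam hlow

/-- **The `p = 3` sentence: on X12 ∧ `3 ∣ N` ∧ `K ≠ ℚ(√−3)`, modulo the Manin datum and `3 ∤ ∏c_ℓ`,
`BSD(E,3) ⟺ MissingLowerBoundAt W 3`.** [cite: MatarNekovar2019, Thm. 0.3 and §0.11]
[cite: Miller2011LMS, §1 and Def. 1.1] -/
theorem bsdp_three_iff_missingLowerBoundAt_of_classX12_of_bad
    (W : WeierstrassCurve ℚ) [W.IsElliptic] [W.IsGloballyMinimal] [NeZero (W.conductorNorm ℤ)]
    (hX : ClassX12 W 3) (hbad : ¬ Good W 3) (hnr : ¬ CMRamified W 3)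
    (D : ModularParametrizationData W (W.conductorNorm ℤ)) (hc : ¬ (3 : ℤ) ∣ D.c)
    (htam : ¬ 3 ∣ W.tamagawaProduct) :
    BSDp W 3 ↔ MissingLowerBoundAt W 3 :=
  bsdp_iff_missingLowerBoundAt_of_classX12_of_bad_odd hGZ hKo hMN hGZK hmod hnf hFH hCM8 W 3 hX (by decide)
    hbad hnr D (by exact_mod_cast hc) htam

end Summit.BirchSwinnertonDyer.Rank1Residual.X12

end
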